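import Summits.ValiantsHypothesis.ValiantsHypothesis.Theorems.NewtonUnitEquationsTwoProductsRankOneThreeLawCount
import HarnessLib

/-!
# Route NewtonUnitEquations — crux `TwoProducts` (stmt-ValiantsHypothesis-5906), line `relation_ladder`, rung R6b (three-term
# rank one, shape `α = β + γ`): the FREE LIFT — `RankOneThreeLaw`, UNCONDITIONAL — part 6/6 — the arithmetic and the law `rankOneThreeLaw_proof` (Part T8, end)

(T8, end) the arithmetic `arith_R6b` (`(m+1)(s+2)^3(N_m+2)^{3(log₂(N_m+2)+1)} ≤ 2^{649 m}(s+2)^{649}`, `N_m = 2m(m+1)^3 + 1`) and the law,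
stated by its LITERAL body: `rankOneThreeLaw_proof` (degenerate case via R3♯ `permTypeLaw_proof`).

val-idea-8 g3 (ideator; lens decomp), 2026-08-28. Companion of the R6 module (shape `α + β = γ + δ`, Segre lift). New ingredient: the
relation is INHOMOGENEOUS, so the fibres of the lift `Y_α ↦ Y_β Y_γ` have VARYING letter count and the slice sums are no longer
binomial-exponential sums of bounded width; they carry the extra factor `C(λ(ν) + b - 1 - k, b - k)` with `λ` an ADDITIVE form, which still has
finite SHIFT RANK — so val-lit-p3's general strict-pencil-minimiser count for finite shift rank (`…FormalLogLinearisation.ShiftRank.pencilCount`,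
LANDED p620579) applies BY NAME.

PORT NOTE (val-lit-p3 g15, prover seat, helper mode `--supports stmt-ValiantsHypothesis-5906 --as helper`, no stub credit claimed;
desk RULING #279 (c)): part 6/6 of a VERBATIM Theorems-side port of val-idea-8 g3's sorry-free module
`Cruxes/TwoProducts/Lines/relation_ladder_R6b.lean` (tree @988ccfe3a7f4; file sha256 da7520fdfde8796f…; 1 661 lines; `lean check` rc 0,
0 sorries) into files of ≤ 400 lines, following the R6 port (`…RankOneFourLaw{Toric,Fibres,Slice,Planar,Weights,Count}`, p11 g1 / p3 g14).
ALL mathematics and ALL proofs below are val-idea-8 g3's (engine memo `Cruxes/TwoProducts/Lines/relation_ladder_R6_engine.md` rev 3 §7′,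
card `Lines/relation_ladder.md` v14). The port changes only: (i) the file split and the import chain; (ii) the generic toolkit that the source
re-declares VERBATIM from the R6 module (`phiT/piT` family, `piT_apply`, `ofFun`, `multinomial_univ`, `tab`, `sgn`, `binChar` + lemmas,
`toolBound_mono`, the toric Lemma A `toric_minLog` with `coeff_zero_phiT_lin/coeff_zero_one_add_phiT_lin/phiT_liftG/phiT_logTrunc`,
`RankOneCoincidences`, `rankOneCoincidences_of_permType`, `msetT_apply_eq_zero`, `idxOf`, `enum_idxOf`, `rW`, `lwt_single`, `lwt_piT`) is NOT
re-declared but IMPORTED from the landed R6 port (`…RankOneFourLaw*`, namespace `…PermutationType`, identical texts), so every such name below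
resolves to the landed declaration; (iii) `set_option linter.deprecated false` dropped; (iv) one-line docstrings on API lemmas required by the
tree's docstring lint; (v) in part 6/6 the parameter-free `def RankOneThreeLaw : Prop` is NOT declared (the gate relocates such defs, cf. the R6
port delta p622844) — the law is stated by its LITERAL body as `rankOneThreeLaw_proof`. Namespace = the author's (`…PermutationType.R6b`).
Nothing here closes the line's residual, the crux `TwoProducts` (5906) or `VP ≠ VNP`; no summit statement is proved.

Honest scope (the author's): the shape `2β = α + γ` (R6c) and coincidence rank `≥ 2` (R7) are NOT covered here and go to the residual of
skeleton v15. Nothing here moves VP ≠ VNP; `TwoProducts` (5906) stays OPEN. [folklore]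
-/

noncomputable section

-- Sub = Summit single-conjunct layout: the duplicated namespace component is mandated by the tree.
set_option linter.dupNamespace false
set_option linter.unusedSimpArgs false
set_option linter.unusedSectionVars false

namespace Summit.ValiantsHypothesis.ValiantsHypothesis.Theorems.NewtonUnitEquations.TwoProducts.PermutationType
namespace R6b
open scoped BigOperators
open MvPolynomial

variable {σ : Type*} [Fintype σ] [DecidableEq σ]

variable (I : ThreeIdx σ)

section FreeCount
open Summit.ValiantsHypothesis.ValiantsHypothesis.Theorems.NewtonUnitEquations.TwoProducts.FormalLogLinearisation
open Summit.ValiantsHypothesis.ValiantsHypothesis.Theorems.NewtonUnitEquations.TwoProducts.PlanarCell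

variable {m : ℕ} {u v : Fin m → MvPolynomial (Fin 2) ℂ} (D : RelData u v)

omit [Fintype σ] [DecidableEq σ] in
/-- Arithmetic: `N_m + 2 ≤ 2(m+1)^4`. [folklore] -/
theorem Nm_add_two_le (m : ℕ) (hm : 1 ≤ m) : Nm m + 2 ≤ 2 * (m + 1) ^ 4 := by
  unfold Nm
  have h3 : 8 ≤ (m + 1) ^ 3 := by
    calc 8 = 2 ^ 3 := by norm_num
      _ ≤ (m + 1) ^ 3 := Nat.pow_le_pow_left (by omega) 3
  have e2 : (m + 1) ^ 4 = m * (m + 1) ^ 3 + (m + 1) ^ 3 := by ring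
  have e1 : 2 * m * (m + 1) ^ 3 = 2 * (m * (m + 1) ^ 3) := by ring
  rw [e2, e1]
  omega

omit [Fintype σ] [DecidableEq σ] in
/-- Arithmetic: `N_m + 2 < 2^{4 log₂(m+1) + 5}`. [folklore] -/
theorem Nm_add_two_lt (m : ℕ) (hm : 1 ≤ m) : Nm m + 2 < 2 ^ (4 * Nat.log 2 (m + 1) + 5) := by
  have hp1 : m + 1 < 2 ^ (Nat.log 2 (m + 1) + 1) := Nat.lt_pow_succ_log_self (by norm_num) (m + 1)
  have h4 : (m + 1) ^ 4 < (2 ^ (Nat.log 2 (m + 1) + 1)) ^ 4 := Nat.pow_lt_pow_left hp1 (by norm_num)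
  have e3 : 2 * (2 ^ (Nat.log 2 (m + 1) + 1)) ^ 4 = 2 ^ (4 * Nat.log 2 (m + 1) + 5) := by
    rw [← pow_mul, ← pow_succ']
    congr 1
    ring
  have h1 := Nm_add_two_le m hm
  omega

omit [Fintype σ] [DecidableEq σ] in
/-- Arithmetic: `log₂(N_m + 2) + 1 ≤ 4 log₂(m+1) + 5`. [folklore] -/
theorem logNm_le (m : ℕ) (hm : 1 ≤ m) : Nat.log 2 (Nm m + 2) + 1 ≤ 4 * Nat.log 2 (m + 1) + 5 := by
  have := Nat.log_lt_of_lt_pow (by omega : Nm m + 2 ≠ 0) (Nm_add_two_lt m hm)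
  omega

omit [Fintype σ] [DecidableEq σ] in
/-- Arithmetic: `(4 log₂(m+1) + 5)² ≤ 194 m`. [folklore] -/
theorem sqlog_le (m : ℕ) (hm : 1 ≤ m) :
    (4 * Nat.log 2 (m + 1) + 5) * (4 * Nat.log 2 (m + 1) + 5) ≤ 194 * m := by
  have hp2 : 2 ^ Nat.log 2 (m + 1) ≤ m + 1 := Nat.pow_log_le_self 2 (by omega)
  have hpp : Nat.log 2 (m + 1) < 2 ^ Nat.log 2 (m + 1) := Nat.lt_two_pow_self
  have hp3 : Nat.log 2 (m + 1) * Nat.log 2 (m + 1) ≤ 2 ^ (Nat.log 2 (m + 1) + 1) := sq_le_two_pow_succ _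
  have h2p : 2 ^ (Nat.log 2 (m + 1) + 1) = 2 * 2 ^ Nat.log 2 (m + 1) := pow_succ' 2 _
  have e4 : (4 * Nat.log 2 (m + 1) + 5) * (4 * Nat.log 2 (m + 1) + 5) =
      16 * (Nat.log 2 (m + 1) * Nat.log 2 (m + 1)) + 40 * Nat.log 2 (m + 1) + 25 := by ring
  rw [e4]
  omega

omit [Fintype σ] [DecidableEq σ] in
/-- Arithmetic: `(N_m + 2)^{3(log₂(N_m+2)+1)} ≤ 2^{582 m}`. [folklore] -/
theorem powNm_le (m : ℕ) (hm : 1 ≤ m) : (Nm m + 2) ^ (3 * (Nat.log 2 (Nm m + 2) + 1)) ≤ 2 ^ (582 * m) := by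
  have hN2 := Nm_add_two_lt m hm
  have hL := logNm_le m hm
  have hq := sqlog_le m hm
  calc (Nm m + 2) ^ (3 * (Nat.log 2 (Nm m + 2) + 1))
      ≤ (2 ^ (4 * Nat.log 2 (m + 1) + 5)) ^ (3 * (Nat.log 2 (Nm m + 2) + 1)) := Nat.pow_le_pow_left hN2.le _
    _ ≤ (2 ^ (4 * Nat.log 2 (m + 1) + 5)) ^ (3 * (4 * Nat.log 2 (m + 1) + 5)) :=
        Nat.pow_le_pow_right (by positivity) (Nat.mul_le_mul_left _ hL)
    _ = 2 ^ (3 * ((4 * Nat.log 2 (m + 1) + 5) * (4 * Nat.log 2 (m + 1) + 5))) := by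
        rw [← pow_mul]
        congr 1
        ring
    _ ≤ 2 ^ (582 * m) := Nat.pow_le_pow_right (by norm_num) (by omega)

set_option exponentiation.threshold 1024 in
omit [Fintype σ] [DecidableEq σ] in
/-- **Arithmetic**: `(m+1) · sliceBd ≤ 2^{c m} (s+2)^c` and `2^{13m}(s+2)^2 ≤ 2^{c m}(s+2)^c` with `c = 649`
(no `ring` on numeral powers of `s + 2`). [folklore] -/
theorem arith_R6b : ∃ c : ℕ,
    (∀ m s : ℕ, 1 ≤ m → (m + 1) * sliceBd m s ≤ 2 ^ (c * m) * (s + 2) ^ c) ∧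
    (∀ m s : ℕ, 2 ^ (13 * m) * (s + 2) ^ 2 ≤ 2 ^ (c * m) * (s + 2) ^ c) := by
  refine ⟨649, fun m s hm => ?_, fun m s => ?_⟩
  · have hm1 : m + 1 ≤ 2 ^ m := Nat.lt_two_pow_self
    have hsA : (s + 2) ^ 3 ≤ (s + 2) ^ 649 := Nat.pow_le_pow_right (by omega) (by norm_num)
    have hpow := powNm_le m hm
    have h2m : 2 ^ m * 2 ^ (582 * m) ≤ 2 ^ (649 * m) := by
      rw [← pow_add]
      exact Nat.pow_le_pow_right (by norm_num) (by omega)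
    unfold sliceBd
    calc (m + 1) * ((s + 2) ^ 3 * (Nm m + 2) ^ (3 * (Nat.log 2 (Nm m + 2) + 1)))
        ≤ 2 ^ m * ((s + 2) ^ 649 * 2 ^ (582 * m)) := Nat.mul_le_mul hm1 (Nat.mul_le_mul hsA hpow)
      _ = 2 ^ m * 2 ^ (582 * m) * (s + 2) ^ 649 := by
          rw [Nat.mul_comm ((s + 2) ^ 649) (2 ^ (582 * m)), ← Nat.mul_assoc]
      _ ≤ 2 ^ (649 * m) * (s + 2) ^ 649 := Nat.mul_le_mul_right _ h2m
  · exact Nat.mul_le_mul (Nat.pow_le_pow_right (by norm_num) (by omega))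
      (Nat.pow_le_pow_right (by omega) (by norm_num))


omit [Fintype σ] [DecidableEq σ] in
/-- **R6b — THE THREE-TERM RANK-ONE LAW (shape `α = β + γ`), UNCONDITIONAL** (val-idea-8 g3's `rankOneThreeLaw : RankOneThreeLaw` — free
lift + toric Lemma A + `b`-slicing + coefficient theorem with varying letter count + finite shift rank + val-lit-p3's `ShiftRank.pencilCount`).
If ALL additive coincidences of the letter family come from ONE three-term relation `α = β + γ` among distinct letters (rank-one coincidence
lattice), then GLOBALLY `#visible ≤ 2^{c m} (#T + 2)^c`.  PORT DELTA (val-lit-p3 g15, filing seat): the source states this as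
`def RankOneThreeLaw : Prop := …` + `theorem rankOneThreeLaw : RankOneThreeLaw`; parameter-free `def … : Prop`s are relocated by the gate
(bounce p622844), so — exactly as the R3♯/R6 ports' `permTypeLaw_proof`/`rankOneFourLaw_proof` — the law is stated by its LITERAL body and
proved outright (the line file wires its own `RankOneThreeLaw` def against this theorem by `exact`).  Nothing here closes the residual of the
line, the crux `TwoProducts` (5906) or `VP ≠ VNP`. [folklore] -/
theorem rankOneThreeLaw_proof :
  ∃ c : ℕ, ∀ (m : ℕ) (u v : Fin m → MvPolynomial (Fin 2) ℂ), (∀ j, coeff 0 (u j) = 0) → (∀ j, coeff 0 (v j) = 0) →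
    (∃ α β γ : Expo, α ≠ β ∧ α ≠ γ ∧ β ≠ γ ∧ α = β + γ ∧
      RankOneCoincidences (fun j => (u j).support ∪ (v j).support)
        (Finsupp.single β 1 + Finsupp.single γ 1) (Finsupp.single α 1)) →
    ∀ S : Finset Expo, (∀ l ∈ S, ∃ ξ : Fin 2 → ℝ, ValidWeight u v ξ ∧ IsStrictTop ξ ↑(tailDiff u v).support l) →
      S.card ≤ 2 ^ (c * m) * ((tailSupport u v).card + 2) ^ c := by

  classical
  obtain ⟨c, hc1, hc2⟩ := arith_R6b
  refine ⟨c, fun m u v hu hv hrel S hS => ?_⟩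
  obtain ⟨α, β, γ, hab, hac, hbc, hrel, hR⟩ := hrel
  rcases S.eq_empty_or_nonempty with hSe | hSne
  · simp [hSe]
  obtain ⟨l₀, hl₀⟩ := hSne
  obtain ⟨ξ₀, hval₀, htop₀⟩ := hS l₀ hl₀
  have hm : 1 ≤ m := by
    rcases Nat.eq_zero_or_pos m with h | h
    · exfalso
      subst h
      apply mem_support_iff.mp htop₀.1
      unfold tailDiff
      simp
    · exact h
  by_cases hall : α ∈ tailSupport u v ∧ β ∈ tailSupport u v ∧ γ ∈ tailSupport u v
  · obtain ⟨hα, hβ, hγ⟩ := hall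
    let D : RelData u v := ⟨α, β, γ, hα, hβ, hγ, hab, hac, hbc, hrel⟩
    have h := (D.count hu hv hR S hS).trans (hc1 m (sE u v) hm)
    exact h
  · have hex : ∃ e : Expo, (e = α ∨ e = β ∨ e = γ) ∧ e ∉ tailSupport u v := by
      simp only [not_and_or] at hall
      rcases hall with h | h | h
      exacts [⟨α, Or.inl rfl, h⟩, ⟨β, Or.inr (Or.inl rfl), h⟩, ⟨γ, Or.inr (Or.inr rfl), h⟩]
    obtain ⟨e, he, hnot⟩ := hex
    have hnotj : ∀ j, e ∉ (u j).support ∪ (v j).support := by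
      intro j hj
      apply hnot
      rcases Finset.mem_union.mp hj with h | h
      · exact support_u_subset u v j h
      · exact support_v_subset u v j h
    have hperm : PermType (fun j => (u j).support ∪ (v j).support) :=
      permType_of_absent_letter _ α β γ hab hac hbc hR e he hnotj
    calc S.card ≤ 2 ^ (13 * m) * ((tailSupport u v).card + 2) ^ 2 := permTypeLaw_proof m u v hu hv hperm S hS
      _ ≤ 2 ^ (c * m) * ((tailSupport u v).card + 2) ^ c := hc2 m _

end FreeCount

end R6b
end Summit.ValiantsHypothesis.ValiantsHypothesis.Theorems.NewtonUnitEquations.TwoProducts.PermutationType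

end
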